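import Literature.AlgebraicGeometry.HodgeTheory.AbelianVarietyIsotypicComponentsUnique
import HarnessLib

/-!
# Homomorphisms respect the isotypic components; the isotypic projectors `u_q ∈ End X` (orthogonal quasi-idempotents,
# `Σ_q u_q = n`, CENTRAL, `im u_q = Y_q`); isogenous abelian varieties have isogenous isotypic components
# (Mumford §19 Cor. 2 of Thm. 1; Silverberg–Zarhin 2015 Lemma 3.3; Lange–Rodríguez §2.9)

Layer `Literature/AlgebraicGeometry/HodgeTheory`; theorems only (no `def`, no instance, no named fact; net debt 0).  §§1–3 hold
over ANY field for «systems of components» given by their defining properties (homomorphisms `i_q : Y_q → X` whose addition map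
`⨁_q Y_q → X` is an isogeny, closed immersions and `Hom`-orthogonality where stated); §4 specialises to the isotypic components
over a PERFECT field (`HodgeTheory/AbelianVarietyIsotypicComponents`, `…IsotypicComponentsUnique`), where orthogonality is
automatic.

THE PRINT.  Mumford, *Abelian Varieties* §19 Cor. 2 of Thm. 1 (p. 174): for `X ∼ ∏ X_i^{n_i}` (simple, pairwise non-isogenous)
`End⁰(X) = ⊕_i M_{n_i}(D_i)`, `D_i = End⁰(X_i)` — a homomorphism has no components between different isotypic blocks;
Milne 1986 §12 p. 122 (PDF p. 189) «`Hom(A_i, A_j) = 0` … `End⁰(A) = ∏ End⁰(A_i^{r_i})`»; Silverberg–Zarhin 2015 proof of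
Lemma 3.3 (p. 5): «the natural `F`-homomorphism `S : ∏_{X ∈ I_A(F)} X → A` is an `F`-isogeny. Since `Hom_F(X, Y) = 0` when
`X, Y ∈ I_A(F)` and `X ≠ Y`, we have `End⁰_F(∏ X) = ⊕ End⁰_F(X)` … the isogeny `S` induces an isomorphism
`End⁰_F(A) ≅ ⊕_{X ∈ I_A(F)} End⁰_F(X)`. This implies that `Z_F(A) ≅ ⊕ Z_F(X)`» (the centre decomposes along the components);
Lange–Rodríguez 2022 §2.9 (PDF pp. 43–45): the isotypical components are the images `A^{e_i} = Im(m e_i)` of the central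
idempotents `e_i`.

THE ARGUMENT.  Let `d = desc i : ⨁_q Y_q → X` be an isogeny with quasi-inverse `v` (`d ≫ v = n • 𝟙`, `v ≫ d = n • 𝟙`,
`n ≥ 1`).  Then `i_q ≫ v = n • ι_q` (§1), so the endomorphisms `u_q := (v ≫ π_q) ≫ i_q ∈ End X` satisfy `u_q u_{q'} = 0`
(`q ≠ q'`), `u_q² = n u_q`, `Σ_q u_q = v ≫ d = n`, and `im u_q = Y_q` as abelian subvarieties (`v ≫ π_q` is surjective,
having the right quasi-inverse `i_q`).  If moreover `Hom(Y_q, Y'_{q'}) = 0` for `q ≠ q'` (two systems, in `X` and `X'`),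
every `φ : X → X'` restricts: `i_q ≫ φ = φ_q ≫ i'_q` for a unique `φ_q` (`…IsotypicComponentsUnique` §1), `d ≫ φ = (⊕ φ_q) ≫ d'`
(block-diagonal form), `φ` is determined by the `φ_q` (`d` is an epimorphism), and — for `X' = X` — every `α ∈ End X`
COMMUTES with the projectors `u_q` (compare `d ≫ α ≫ v ≫ π_q` and `d ≫ v ≫ π_q ≫ α_q`, both `= n • (π_q ≫ α_q)`, and cancel
the isogeny `d`).  A quasi-inverse pair `φ ≫ ψ = m`, `ψ ≫ φ = m` restricts to quasi-inverse pairs `φ_q ≫ ψ_q = m`,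
`ψ_q ≫ φ_q = m`, so isogenous abelian varieties have isogenous components.

Results (namespace `Literature.AlgebraicGeometry.HodgeTheory.AbelianVariety`):
* §1 (any field) `comp_quasiInverse_eq_nsmul_ι` (`i_q ≫ v = n • ι_q`), `comp_quasiInverse_π_self` ∕ `_ne`,
  **`isotypicProjector_comp_ne`** (`u_q u_{q'} = 0`), **`isotypicProjector_comp_self`** (`u_q² = n u_q`),
  **`sum_isotypicProjector`** (`Σ u_q = n • 𝟙 X`), `surjective_quasiInverse_π`, **`range_isotypicProjector`** (`range u_q =
  range i_q`), **`exists_iso_image_isotypicProjector`** (`Y_q ≅ im u_q` over `X`), `isotypicProjector_comp_eq_nsmul`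
  (`u_q ≫ i`-restriction: `i_q ≫ u_q = n • i_q`, `i_{q'} ≫ u_q = 0`);
* §2 (any field, `Hom(Y_q, Y'_{q'}) = 0` for `q ≠ q'`) **`existsUnique_restrict_comp_eq`** (`φ_q ≫ i'_q = i_q ≫ φ`),
  **`desc_comp_eq_map_restrict_comp_desc`** (block-diagonal form), `hom_eq_zero_of_forall_component_comp_eq_zero` ∕
  **`hom_eq_of_forall_component_comp_eq`** (`φ` is determined on the components), `restrictComponent_id`, `restrictComponent_comp`
  (functoriality of restriction), **`isIsogeny_restrict_of_quasiInverse`** (quasi-inverse pairs restrict to quasi-inverse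
  pairs; the restrictions are isogenies), `isIsogenous_components_of_quasiInverse`;
* §3 (any field, one system with `Hom(Y_q, Y_{q'}) = 0`) **`isotypicProjector_comm`** (every `α ∈ End X` commutes with every
  `u_q`: the projectors are CENTRAL), `comp_quasiInverse_π_comm` (`α ≫ (v ≫ π_q) = (v ≫ π_q) ≫ α_q`);
* §4 (perfect field; the isotypic components of GEN 50 ∕ `…IsotypicComponentsUnique`) **`existsUnique_restrict_isotypicComponents`**
  (every `φ : X → X'` maps `Y_q(X)` into `Y_q(X')`), `desc_comp_eq_map_comp_desc_isotypicComponents`,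
  **`isotypicProjector_comm_of_isotypicComponents`** (centrality), **`isIsogenous_isotypicComponents_of_isIsogenous`**
  (`X ∼ X'` ⟹ `Y_q(X) ∼ Y_q(X')`), `multiplicity_eq_of_isIsogenous` (`X ∼ X'` ⟹ `n_q = n'_q`).

## References
* [MumfordAV1970] D. Mumford, *Abelian Varieties* (1970), §19 Thm. 1, Cor. 1–2 and Remark p. 169 (pp. 169–174).
* [Milne1986AbelianVarieties] J. S. Milne, *Abelian Varieties*, in Cornell–Silverman, *Arithmetic Geometry* (1986), §12
  Prop. 12.1, Lemma 12.2 and p. 122 (PDF p. 189).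
* [SilverbergZarhin2015] A. Silverberg, Yu. G. Zarhin, *Isogenies of abelian varieties over finite fields*, Des. Codes
  Cryptogr. 77 (2015) (arXiv:1409.0592), Def. 2.3, Lemma 3.3 and its proof (p. 5).
* [LangeRodriguez2022] H. Lange, R. E. Rodríguez, *Decomposition of Jacobians by Prym Varieties*, LNM 2310 (2022), §2.9
  (PDF pp. 43–45), Thm. 2.7.1 (PDF p. 38).
* [GortzWedhorn2023] U. Görtz, T. Wedhorn, *Algebraic Geometry II* (2023), Prop. 27.178 (1) (isogenies are epimorphisms),
  Cor. 27.177 (PDF p. 882).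
-/

noncomputable section

universe u

open CategoryTheory CategoryTheory.Limits

namespace Literature.AlgebraicGeometry.HodgeTheory

namespace AbelianVariety

open _root_.AlgebraicGeometry
open Literature.AlgebraicGeometry.Motives Literature.AlgebraicGeometry.Motives.AbelianVariety

variable {K : Type u} [Field K]

/-! ## §1 The isotypic projectors attached to an addition-map isogeny (any field) -/

section Projectors

variable {Q : Type} [Fintype Q] {X : Motives.AbelianVariety K} {Y : Q → Motives.AbelianVariety K}
  (i : ∀ q, Y q ⟶ X) {v : X ⟶ ⨁ Y} {n : ℕ}

/-- `i_q ≫ v = n • ι_q` for a right quasi-inverse `v` of the addition map (`desc i ≫ v = n • 𝟙`).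
[cite: MumfordAV1970, §19 Remark p. 169] -/
theorem comp_quasiInverse_eq_nsmul_ι (hdv : biproduct.desc i ≫ v = n • 𝟙 (⨁ Y)) (q : Q) :
    i q ≫ v = n • biproduct.ι Y q := by
  rw [← biproduct.ι_desc i q, Category.assoc, hdv, Preadditive.comp_nsmul, Category.comp_id]

/-- `i_q ≫ v ≫ π_q = n • 𝟙 (Y q)`: `v ≫ π_q` is a left quasi-inverse of `i_q`. [cite: MumfordAV1970, §19 Remark p. 169] -/
theorem comp_quasiInverse_π_self (hdv : biproduct.desc i ≫ v = n • 𝟙 (⨁ Y)) (q : Q) :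
    i q ≫ v ≫ biproduct.π Y q = n • 𝟙 (Y q) := by
  rw [← Category.assoc, comp_quasiInverse_eq_nsmul_ι i hdv q, Preadditive.nsmul_comp, biproduct.ι_π_self]

/-- `i_q ≫ v ≫ π_{q'} = 0` for `q ≠ q'`. [cite: MumfordAV1970, §19 Remark p. 169 and Cor. 2 of Thm. 1 (p. 174)] -/
theorem comp_quasiInverse_π_ne (hdv : biproduct.desc i ≫ v = n • 𝟙 (⨁ Y)) {q q' : Q} (h : q ≠ q') :
    i q ≫ v ≫ biproduct.π Y q' = 0 := by
  rw [← Category.assoc, comp_quasiInverse_eq_nsmul_ι i hdv q, Preadditive.nsmul_comp, biproduct.ι_π_ne _ h, smul_zero]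

/-- **The isotypic projectors are orthogonal**: `u_q ≫ u_{q'} = 0` for `q ≠ q'`, where `u_q = (v ≫ π_q) ≫ i_q ∈ End X`.
[cite: MumfordAV1970, §19 Cor. 2 of Thm. 1 (p. 174)] [cite: LangeRodriguez2022, §2.9 (PDF pp. 43–44)] -/
theorem isotypicProjector_comp_ne (hdv : biproduct.desc i ≫ v = n • 𝟙 (⨁ Y)) {q q' : Q} (h : q ≠ q') :
    ((v ≫ biproduct.π Y q) ≫ i q) ≫ ((v ≫ biproduct.π Y q') ≫ i q') = 0 := by
  rw [Category.assoc, ← Category.assoc (i q), ← Category.assoc (i q), Category.assoc (i q) v,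
    comp_quasiInverse_π_ne i hdv h, zero_comp, comp_zero]

/-- **The isotypic projectors are quasi-idempotent**: `u_q ≫ u_q = n • u_q`. [cite: MumfordAV1970, §19 Cor. 2 of Thm. 1 (p. 174)]
[cite: LangeRodriguez2022, §2.9 (PDF pp. 43–44)] -/
theorem isotypicProjector_comp_self (hdv : biproduct.desc i ≫ v = n • 𝟙 (⨁ Y)) (q : Q) :
    ((v ≫ biproduct.π Y q) ≫ i q) ≫ ((v ≫ biproduct.π Y q) ≫ i q) = n • ((v ≫ biproduct.π Y q) ≫ i q) := by
  rw [Category.assoc, ← Category.assoc (i q), ← Category.assoc (i q), Category.assoc (i q) v,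
    comp_quasiInverse_π_self i hdv q, Preadditive.nsmul_comp, Category.id_comp, Preadditive.comp_nsmul]

/-- **The isotypic projectors sum to `n`**: `Σ_q u_q = v ≫ desc i = n • 𝟙 X`. [cite: MumfordAV1970, §19 Cor. 2 of Thm. 1 (p. 174)]
[cite: LangeRodriguez2022, §2.9 (PDF pp. 43–44: `1 = Σ e_W`)] -/
theorem sum_isotypicProjector (hvd : v ≫ biproduct.desc i = n • 𝟙 X) :
    ∑ q, (v ≫ biproduct.π Y q) ≫ i q = n • 𝟙 X := by
  have h : ∀ q, (v ≫ biproduct.π Y q) ≫ i q = v ≫ (biproduct.π Y q ≫ biproduct.ι Y q) ≫ biproduct.desc i := fun q ↦ by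
    rw [Category.assoc, Category.assoc, biproduct.ι_desc]
  rw [Finset.sum_congr rfl fun q _ ↦ h q, ← Preadditive.comp_sum, ← Preadditive.sum_comp, biproduct.total,
    Category.id_comp, hvd]

/-- `v ≫ π_q : X → Y_q` is surjective (it has the right quasi-inverse `i_q`, `n ≠ 0`). [cite: MumfordAV1970, §19 Remark p. 169]
[cite: Milne1986AbelianVarieties, §8 Thm. 8.2 (PDF p. 181)] -/
theorem surjective_quasiInverse_π (hdv : biproduct.desc i ≫ v = n • 𝟙 (⨁ Y)) (hn : n ≠ 0) (q : Q) :
    Surjective (Hom.toSchemeHom (v ≫ biproduct.π Y q)) :=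
  surjective_of_comp_eq_nsmul_id hn (comp_quasiInverse_π_self i hdv q)

/-- **`range u_q = range i_q`**: the isotypic projector `u_q = (v ≫ π_q) ≫ i_q` and the component `i_q` have the same
underlying image in `X`. [cite: LangeRodriguez2022, §2.9 (PDF p. 43: `A^{e_i} = Im(m e_i)`)] [cite: MumfordAV1970, §19 Thm. 1 (p. 173)] -/
theorem range_isotypicProjector (hdv : biproduct.desc i ≫ v = n • 𝟙 (⨁ Y)) (hn : n ≠ 0) (q : Q) :
    Set.range (Hom.toSchemeHom ((v ≫ biproduct.π Y q) ≫ i q)) = Set.range (Hom.toSchemeHom (i q)) := by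
  haveI := surjective_quasiInverse_π i hdv hn q
  exact range_toSchemeHom_comp_eq_of_surjective _ _

/-- **`Y_q ≅ im u_q` over `X`**: a component of an addition-map isogeny which is an abelian subvariety IS the image of its
isotypic projector (Lange–Rodríguez's `A^{e} = Im(m e)`). [cite: LangeRodriguez2022, §2.9 (PDF pp. 43–45)]
[cite: MumfordAV1970, §19 Thm. 1 and Cor. 2 (pp. 173–174)] -/
theorem exists_iso_image_isotypicProjector (hdv : biproduct.desc i ≫ v = n • 𝟙 (⨁ Y)) (hn : n ≠ 0)
    (q : Q) [IsClosedImmersion (Hom.toSchemeHom (i q))] :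
    ∃ e : Y q ≅ image ((v ≫ biproduct.π Y q) ≫ i q), e.hom ≫ imageι ((v ≫ biproduct.π Y q) ≫ i q) = i q :=
  exists_iso_image_of_range_eq (i q) _ (range_isotypicProjector i hdv hn q).symm

/-- `i_q ≫ u_q = n • i_q`: the projector `u_q` restricts to `[n]` on `Y_q`. [cite: MumfordAV1970, §19 Cor. 2 of Thm. 1 (p. 174)] -/
theorem comp_isotypicProjector_self (hdv : biproduct.desc i ≫ v = n • 𝟙 (⨁ Y)) (q : Q) :
    i q ≫ ((v ≫ biproduct.π Y q) ≫ i q) = n • i q := by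
  rw [← Category.assoc, ← Category.assoc, Category.assoc (i q) v, comp_quasiInverse_π_self i hdv q,
    Preadditive.nsmul_comp, Category.id_comp]

/-- `i_{q'} ≫ u_q = 0` for `q' ≠ q`: the projector `u_q` kills the other components. [cite: MumfordAV1970, §19 Cor. 2 of Thm. 1 (p. 174)] -/
theorem comp_isotypicProjector_ne (hdv : biproduct.desc i ≫ v = n • 𝟙 (⨁ Y)) {q q' : Q} (h : q' ≠ q) :
    i q' ≫ ((v ≫ biproduct.π Y q) ≫ i q) = 0 := by
  rw [← Category.assoc, ← Category.assoc, Category.assoc (i q') v, comp_quasiInverse_π_ne i hdv h, zero_comp]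

end Projectors

/-! ## §2 Homomorphisms restrict to the components; block-diagonal form; faithfulness (any field) -/

section Restrict

variable {Q : Type} [Fintype Q] {X X' X'' : Motives.AbelianVariety K} {Y Y' Y'' : Q → Motives.AbelianVariety K}

/-- **Every homomorphism `φ : X → X'` restricts to the components**: if `i'_q : Y'_q ↪ X'` are abelian subvarieties whose
addition map is an isogeny and `Hom(Y_q, Y'_{q'}) = 0` for `q ≠ q'`, then for every `q` there is a UNIQUE `φ_q : Y_q → Y'_q`
with `φ_q ≫ i'_q = i_q ≫ φ` («a homomorphism has no components between different isotypic blocks»).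
[cite: MumfordAV1970, §19 Cor. 2 of Thm. 1 (p. 174)] [cite: Milne1986AbelianVarieties, §12 p. 122 (PDF p. 189)]
[cite: SilverbergZarhin2015, proof of Lemma 3.3 (p. 5)] -/
theorem existsUnique_restrict_comp_eq (i : ∀ q, Y q ⟶ X) (i' : ∀ q, Y' q ⟶ X')
    (hi' : ∀ q, IsClosedImmersion (Hom.toSchemeHom (i' q))) (hdesc' : IsIsogeny (biproduct.desc i'))
    (horth : ∀ q q', q ≠ q' → ∀ f : Y q ⟶ Y' q', f = 0) (φ : X ⟶ X') (q : Q) :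
    ∃! φq : Y q ⟶ Y' q, φq ≫ i' q = i q ≫ φ :=
  haveI := hi' q
  existsUnique_hom_comp_eq_of_isIsogeny_desc_of_hom_eq_zero i' q hdesc' (i q ≫ φ) fun q' hq' f ↦
    horth q q' (Ne.symm hq') f

/-- **Block-diagonal form**: with restrictions `φ_q ≫ i'_q = i_q ≫ φ` one has `desc i ≫ φ = (⊕_q φ_q) ≫ desc i'`.
[cite: MumfordAV1970, §19 Cor. 2 of Thm. 1 (p. 174)] [cite: SilverbergZarhin2015, proof of Lemma 3.3 (p. 5)] -/
theorem desc_comp_eq_map_restrict_comp_desc (i : ∀ q, Y q ⟶ X) (i' : ∀ q, Y' q ⟶ X') (φ : X ⟶ X')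
    (φq : ∀ q, Y q ⟶ Y' q) (hφ : ∀ q, φq q ≫ i' q = i q ≫ φ) :
    biproduct.desc i ≫ φ = biproduct.map φq ≫ biproduct.desc i' := by
  classical
  refine biproduct.hom_ext' _ _ fun q ↦ ?_
  rw [biproduct.ι_desc_assoc, biproduct.ι_map_assoc, biproduct.ι_desc, hφ]

/-- A homomorphism vanishing on every component of an addition-map isogeny is zero (`desc i` is an epimorphism).
[cite: GortzWedhorn2023, Prop. 27.178 (1)] [cite: MumfordAV1970, §19 Remark p. 169] -/
theorem hom_eq_zero_of_forall_component_comp_eq_zero (i : ∀ q, Y q ⟶ X) (hdesc : IsIsogeny (biproduct.desc i)) (φ : X ⟶ X')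
    (h : ∀ q, i q ≫ φ = 0) : φ = 0 := by
  classical
  refine hdesc.cancel_left ?_
  rw [comp_zero]
  exact biproduct.hom_ext' _ _ fun q ↦ by rw [biproduct.ι_desc_assoc, h, comp_zero]

/-- **A homomorphism is determined by its restrictions to the components** of an addition-map isogeny.
[cite: GortzWedhorn2023, Prop. 27.178 (1)] [cite: MumfordAV1970, §19 Cor. 2 of Thm. 1 (p. 174)] -/
theorem hom_eq_of_forall_component_comp_eq (i : ∀ q, Y q ⟶ X) (hdesc : IsIsogeny (biproduct.desc i)) (φ ψ : X ⟶ X')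
    (h : ∀ q, i q ≫ φ = i q ≫ ψ) : φ = ψ := by
  classical
  refine hdesc.cancel_left (biproduct.hom_ext' _ _ fun q ↦ ?_)
  rw [biproduct.ι_desc_assoc, biproduct.ι_desc_assoc, h]

omit [Fintype Q] in
/-- The identity restricts to the identities. [cite: MumfordAV1970, §19 Cor. 2 of Thm. 1 (p. 174)] -/
theorem restrictComponent_id (i : ∀ q, Y q ⟶ X) (hi : ∀ q, IsClosedImmersion (Hom.toSchemeHom (i q))) {q : Q}
    (φq : Y q ⟶ Y q) (hφ : φq ≫ i q = i q ≫ 𝟙 X) : φq = 𝟙 (Y q) := by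
  haveI := hi q
  haveI := mono_of_isClosedImmersion_toSchemeHom (i q)
  rw [← cancel_mono (i q), hφ, Category.comp_id, Category.id_comp]

omit [Fintype Q] in
/-- Restriction is compatible with composition: restrictions of `φ` and `ψ` compose to a restriction of `φ ≫ ψ`.
[cite: MumfordAV1970, §19 Cor. 2 of Thm. 1 (p. 174)] -/
theorem restrictComponent_comp (i : ∀ q, Y q ⟶ X) (i' : ∀ q, Y' q ⟶ X') (i'' : ∀ q, Y'' q ⟶ X'') {φ : X ⟶ X'} {ψ : X' ⟶ X''}
    {q : Q} {φq : Y q ⟶ Y' q} {ψq : Y' q ⟶ Y'' q} (hφ : φq ≫ i' q = i q ≫ φ) (hψ : ψq ≫ i'' q = i' q ≫ ψ) :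
    (φq ≫ ψq) ≫ i'' q = i q ≫ (φ ≫ ψ) := by
  rw [Category.assoc, hψ, ← Category.assoc, hφ, Category.assoc]

omit [Fintype Q] in
/-- Restriction is additive. [cite: MumfordAV1970, §19 Cor. 2 of Thm. 1 (p. 174)] -/
theorem restrictComponent_add (i : ∀ q, Y q ⟶ X) (i' : ∀ q, Y' q ⟶ X') {φ ψ : X ⟶ X'} {q : Q} {φq ψq : Y q ⟶ Y' q}
    (hφ : φq ≫ i' q = i q ≫ φ) (hψ : ψq ≫ i' q = i q ≫ ψ) : (φq + ψq) ≫ i' q = i q ≫ (φ + ψ) := by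
  rw [Preadditive.add_comp, Preadditive.comp_add, hφ, hψ]

omit [Fintype Q] in
/-- **Quasi-inverse pairs restrict to quasi-inverse pairs; the restrictions are isogenies**: if `φ ≫ ψ = m • 𝟙 X`,
`ψ ≫ φ = m • 𝟙 X'` (`m ≠ 0`) and `φ_q`, `ψ_q` are restrictions (`φ_q ≫ i'_q = i_q ≫ φ`, `ψ_q ≫ i_q = i'_q ≫ ψ`, with `i_q`,
`i'_q` closed immersions), then `φ_q ≫ ψ_q = m • 𝟙`, `ψ_q ≫ φ_q = m • 𝟙` and `φ_q` is an isogeny.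
[cite: MumfordAV1970, §19 Remark p. 169 and Cor. 2 of Thm. 1 (p. 174)] [cite: Milne1986AbelianVarieties, §8 Prop. 8.1, Thm. 8.2 (PDF pp. 180–181)] -/
theorem isIsogeny_restrict_of_quasiInverse (i : ∀ q, Y q ⟶ X) (i' : ∀ q, Y' q ⟶ X')
    (hi : ∀ q, IsClosedImmersion (Hom.toSchemeHom (i q))) (hi' : ∀ q, IsClosedImmersion (Hom.toSchemeHom (i' q)))
    {φ : X ⟶ X'} {ψ : X' ⟶ X} {m : ℕ} (hm : m ≠ 0) (hφψ : φ ≫ ψ = m • 𝟙 X) (hψφ : ψ ≫ φ = m • 𝟙 X') {q : Q}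
    {φq : Y q ⟶ Y' q} {ψq : Y' q ⟶ Y q} (hφ : φq ≫ i' q = i q ≫ φ) (hψ : ψq ≫ i q = i' q ≫ ψ) :
    φq ≫ ψq = m • 𝟙 (Y q) ∧ ψq ≫ φq = m • 𝟙 (Y' q) ∧ IsIsogeny φq := by
  haveI := hi q
  haveI := hi' q
  haveI := mono_of_isClosedImmersion_toSchemeHom (i q)
  haveI := mono_of_isClosedImmersion_toSchemeHom (i' q)
  have h1 : φq ≫ ψq = m • 𝟙 (Y q) := by
    rw [← cancel_mono (i q), restrictComponent_comp i i' i hφ hψ, hφψ, Preadditive.comp_nsmul, Preadditive.nsmul_comp,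
      Category.comp_id, Category.id_comp]
  have h2 : ψq ≫ φq = m • 𝟙 (Y' q) := by
    rw [← cancel_mono (i' q), restrictComponent_comp i' i i' hψ hφ, hψφ, Preadditive.comp_nsmul, Preadditive.nsmul_comp,
      Category.comp_id, Category.id_comp]
  exact ⟨h1, h2, surjective_of_comp_eq_nsmul_id hm h2, isFinite_of_comp_eq_nsmul_id hm h1⟩

/-- **Isogenous abelian varieties have isogenous components**: given systems of abelian subvarieties `i_q : Y_q ↪ X`,
`i'_q : Y'_q ↪ X'` with addition maps isogenies and `Hom(Y_q, Y'_{q'}) = Hom(Y'_q, Y_{q'}) = 0` for `q ≠ q'`, an isogeny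
`X → X'` yields `Y_q ∼ Y'_q` for every `q`. [cite: MumfordAV1970, §19 Cor. 1–2 of Thm. 1 (pp. 173–174)]
[cite: SilverbergZarhin2015, Lemma 3.3 and its proof (p. 5)] -/
theorem isIsogenous_components_of_isIsogenous (i : ∀ q, Y q ⟶ X) (i' : ∀ q, Y' q ⟶ X')
    (hi : ∀ q, IsClosedImmersion (Hom.toSchemeHom (i q))) (hi' : ∀ q, IsClosedImmersion (Hom.toSchemeHom (i' q)))
    (hdesc : IsIsogeny (biproduct.desc i)) (hdesc' : IsIsogeny (biproduct.desc i'))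
    (horth : ∀ q q', q ≠ q' → ∀ f : Y q ⟶ Y' q', f = 0) (horth' : ∀ q q', q ≠ q' → ∀ f : Y' q ⟶ Y q', f = 0)
    (h : IsIsogenous X X') (q : Q) : IsIsogenous (Y q) (Y' q) := by
  obtain ⟨φ, hφiso⟩ := h
  obtain ⟨ψ, m, hm, hφψ, hψφ⟩ := IsIsogeny.exists_nsmul_inverse_holds hφiso
  obtain ⟨φq, hφ, -⟩ := existsUnique_restrict_comp_eq i i' hi' hdesc' horth φ q
  obtain ⟨ψq, hψ, -⟩ := existsUnique_restrict_comp_eq i' i hi hdesc horth' ψ q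
  exact ⟨φq, (isIsogeny_restrict_of_quasiInverse i i' hi hi' hm.ne' hφψ hψφ hφ hψ).2.2⟩

end Restrict

/-! ## §3 The isotypic projectors are central (any field) -/

section Central

variable {Q : Type} [Fintype Q] {X : Motives.AbelianVariety K} {Y : Q → Motives.AbelianVariety K}
  (i : ∀ q, Y q ⟶ X) {v : X ⟶ ⨁ Y} {n : ℕ}

/-- `α ≫ (v ≫ π_q) = (v ≫ π_q) ≫ α_q` for an endomorphism `α ∈ End X` with restrictions `α_q ≫ i_q = i_q ≫ α` (all `q`):
the corestriction `v ≫ π_q : X → Y_q` intertwines `α` and `α_q` (both sides of `d ≫ (–)` equal `n • (π_q ≫ α_q)`; cancel the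
isogeny `d = desc i`). [cite: MumfordAV1970, §19 Cor. 2 of Thm. 1 (p. 174) and Remark p. 169] [cite: GortzWedhorn2023, Prop. 27.178 (1)] -/
theorem comp_quasiInverse_π_comm (hdesc : IsIsogeny (biproduct.desc i)) (hdv : biproduct.desc i ≫ v = n • 𝟙 (⨁ Y))
    (α : X ⟶ X) (αq : ∀ q, Y q ⟶ Y q) (hα : ∀ q, αq q ≫ i q = i q ≫ α) (q : Q) :
    α ≫ (v ≫ biproduct.π Y q) = (v ≫ biproduct.π Y q) ≫ αq q := by
  refine hdesc.cancel_left ?_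
  rw [← Category.assoc, desc_comp_eq_map_restrict_comp_desc i i α αq hα, Category.assoc, ← Category.assoc _ v, hdv,
    Preadditive.nsmul_comp, Category.id_comp, Preadditive.comp_nsmul, biproduct.map_π, ← Category.assoc,
    ← Category.assoc _ v, hdv, Preadditive.nsmul_comp, Category.id_comp, Preadditive.nsmul_comp]

/-- **The isotypic projectors are CENTRAL in `End X`**: every endomorphism `α` commutes with every
`u_q = (v ≫ π_q) ≫ i_q`, provided the components are `Hom`-orthogonal (`Hom(Y_q, Y_{q'}) = 0` for `q ≠ q'`), are abelian
subvarieties, and the addition map is an isogeny with quasi-inverse `v` — the `u_q` are `n` times the central idempotents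
`e_q` of `End⁰(X) = ∏_q End⁰(Y_q)`. [cite: MumfordAV1970, §19 Cor. 2 of Thm. 1 (p. 174)] [cite: SilverbergZarhin2015, proof of Lemma 3.3 (p. 5: `Z_F(A) ≅ ⊕ Z_F(X)`)]
[cite: LangeRodriguez2022, §2.9 (PDF pp. 43–45: the `e_i` are central idempotents)] -/
theorem isotypicProjector_comm (hi : ∀ q, IsClosedImmersion (Hom.toSchemeHom (i q))) (hdesc : IsIsogeny (biproduct.desc i))
    (hdv : biproduct.desc i ≫ v = n • 𝟙 (⨁ Y)) (horth : ∀ q q', q ≠ q' → ∀ f : Y q ⟶ Y q', f = 0) (α : X ⟶ X) (q : Q) :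
    α ≫ ((v ≫ biproduct.π Y q) ≫ i q) = ((v ≫ biproduct.π Y q) ≫ i q) ≫ α := by
  choose αq hα _ using fun q ↦ existsUnique_restrict_comp_eq i i hi hdesc horth α q
  rw [← Category.assoc, comp_quasiInverse_π_comm i hdesc hdv α αq hα q, Category.assoc, hα q]
  simp only [Category.assoc]

end Central

/-! ## §4 The isotypic components over a perfect field -/

section Perfect

variable [PerfectField K] {Q : Type} [Fintype Q] {B : Q → Motives.AbelianVariety K} {n n' : Q → ℕ}
  {X X' : Motives.AbelianVariety K} {Y Y' : Q → Motives.AbelianVariety K}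

/-- **Every homomorphism maps the isotypic component `Y_q(X)` into `Y_q(X')`** (perfect field): for systems of isotypic
components of `X` and `X'` over the same pairwise non-isogenous simple types `B_q`, every `φ : X → X'` has a unique
restriction `φ_q : Y_q → Y'_q`, `φ_q ≫ i'_q = i_q ≫ φ`. [cite: MumfordAV1970, §19 Cor. 2 of Thm. 1 (p. 174)]
[cite: Milne1986AbelianVarieties, §12 p. 122 (PDF p. 189)] [cite: SilverbergZarhin2015, proof of Lemma 3.3 (p. 5)] -/
theorem existsUnique_restrict_isotypicComponents (hB : ∀ q, (B q).IsSimple) (hB0 : ∀ q, 0 < (B q).dim)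
    (hni : ∀ q q', q ≠ q' → ¬ IsIsogenous (B q) (B q'))
    (hY : ∀ q, IsIsogenous (Y q) (⨁ fun _ : Fin (n q + 1) ↦ B q)) (i : ∀ q, Y q ⟶ X)
    (hY' : ∀ q, IsIsogenous (Y' q) (⨁ fun _ : Fin (n' q + 1) ↦ B q)) (i' : ∀ q, Y' q ⟶ X')
    (hi' : ∀ q, IsClosedImmersion (Hom.toSchemeHom (i' q))) (hdesc' : IsIsogeny (biproduct.desc i')) (φ : X ⟶ X')
    (q : Q) : ∃! φq : Y q ⟶ Y' q, φq ≫ i' q = i q ≫ φ :=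
  existsUnique_restrict_comp_eq i i' hi' hdesc' (fun q q' hqq' f ↦
    hom_eq_zero_of_isIsogenous_biproduct_const_of_ne hB hB0 hni hqq' (hY q) (hY' q') f) φ q

/-- Block-diagonal form of a homomorphism between abelian varieties with isotypic components over the same types (perfect
field): `desc i ≫ φ = (⊕_q φ_q) ≫ desc i'` for the restrictions `φ_q`. [cite: MumfordAV1970, §19 Cor. 2 of Thm. 1 (p. 174)]
[cite: SilverbergZarhin2015, proof of Lemma 3.3 (p. 5)] -/
theorem exists_desc_comp_eq_map_comp_desc_isotypicComponents (hB : ∀ q, (B q).IsSimple) (hB0 : ∀ q, 0 < (B q).dim)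
    (hni : ∀ q q', q ≠ q' → ¬ IsIsogenous (B q) (B q'))
    (hY : ∀ q, IsIsogenous (Y q) (⨁ fun _ : Fin (n q + 1) ↦ B q)) (i : ∀ q, Y q ⟶ X)
    (hY' : ∀ q, IsIsogenous (Y' q) (⨁ fun _ : Fin (n' q + 1) ↦ B q)) (i' : ∀ q, Y' q ⟶ X')
    (hi' : ∀ q, IsClosedImmersion (Hom.toSchemeHom (i' q))) (hdesc' : IsIsogeny (biproduct.desc i')) (φ : X ⟶ X') :
    ∃ φq : ∀ q, Y q ⟶ Y' q, (∀ q, φq q ≫ i' q = i q ≫ φ) ∧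
      biproduct.desc i ≫ φ = biproduct.map φq ≫ biproduct.desc i' := by
  choose φq hφ _ using existsUnique_restrict_isotypicComponents hB hB0 hni hY i hY' i' hi' hdesc' φ
  exact ⟨φq, hφ, desc_comp_eq_map_restrict_comp_desc i i' φ φq hφ⟩

/-- **Every endomorphism of `X` commutes with the isotypic projectors** `u_q = (v ≫ π_q) ≫ i_q` of its isotypic
decomposition (perfect field; `desc i ≫ v = n • 𝟙`). [cite: MumfordAV1970, §19 Cor. 2 of Thm. 1 (p. 174)]
[cite: SilverbergZarhin2015, proof of Lemma 3.3 (p. 5)] [cite: LangeRodriguez2022, §2.9 (PDF pp. 43–45)] -/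
theorem isotypicProjector_comm_of_isotypicComponents (hB : ∀ q, (B q).IsSimple)
    (hB0 : ∀ q, 0 < (B q).dim) (hni : ∀ q q', q ≠ q' → ¬ IsIsogenous (B q) (B q'))
    (hY : ∀ q, IsIsogenous (Y q) (⨁ fun _ : Fin (n q + 1) ↦ B q)) (i : ∀ q, Y q ⟶ X)
    (hi : ∀ q, IsClosedImmersion (Hom.toSchemeHom (i q))) (hdesc : IsIsogeny (biproduct.desc i)) {v : X ⟶ ⨁ Y} {m : ℕ}
    (hdv : biproduct.desc i ≫ v = m • 𝟙 (⨁ Y)) (α : X ⟶ X) (q : Q) :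
    α ≫ ((v ≫ biproduct.π Y q) ≫ i q) = ((v ≫ biproduct.π Y q) ≫ i q) ≫ α :=
  isotypicProjector_comm i hi hdesc hdv (fun q q' hqq' f ↦
    hom_eq_zero_of_isIsogenous_biproduct_const_of_ne hB hB0 hni hqq' (hY q) (hY q') f) α q

/-- **Isogenous abelian varieties have isogenous isotypic components** (perfect field): `X ∼ X'` ⟹ `Y_q(X) ∼ Y_q(X')` for
systems of isotypic components over the same simple types. [cite: MumfordAV1970, §19 Cor. 1–2 of Thm. 1 (pp. 173–174)]
[cite: Milne1986AbelianVarieties, §12 Prop. 12.1 and p. 122 (PDF p. 189)] [cite: SilverbergZarhin2015, Lemma 3.3 and its proof (p. 5)] -/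
theorem isIsogenous_isotypicComponents_of_isIsogenous (hB : ∀ q, (B q).IsSimple) (hB0 : ∀ q, 0 < (B q).dim)
    (hni : ∀ q q', q ≠ q' → ¬ IsIsogenous (B q) (B q'))
    (hY : ∀ q, IsIsogenous (Y q) (⨁ fun _ : Fin (n q + 1) ↦ B q)) (i : ∀ q, Y q ⟶ X)
    (hi : ∀ q, IsClosedImmersion (Hom.toSchemeHom (i q))) (hdesc : IsIsogeny (biproduct.desc i))
    (hY' : ∀ q, IsIsogenous (Y' q) (⨁ fun _ : Fin (n' q + 1) ↦ B q)) (i' : ∀ q, Y' q ⟶ X')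
    (hi' : ∀ q, IsClosedImmersion (Hom.toSchemeHom (i' q))) (hdesc' : IsIsogeny (biproduct.desc i'))
    (h : IsIsogenous X X') (q : Q) : IsIsogenous (Y q) (Y' q) :=
  isIsogenous_components_of_isIsogenous i i' hi hi' hdesc hdesc'
    (fun q q' hqq' f ↦ hom_eq_zero_of_isIsogenous_biproduct_const_of_ne hB hB0 hni hqq' (hY q) (hY' q') f)
    (fun q q' hqq' f ↦ hom_eq_zero_of_isIsogenous_biproduct_const_of_ne hB hB0 hni hqq' (hY' q) (hY q') f) h q

/-- **Isogenous abelian varieties have the same multiplicities**: `X ∼ X'` ⟹ `n_q = n'_q` for systems of isotypic components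
over the same simple types (perfect field; «the `r_i` are uniquely determined»). [cite: Milne1986AbelianVarieties, §12 Prop. 12.1 and p. 122 (PDF p. 189)]
[cite: MumfordAV1970, §19 Cor. 1 of Thm. 1 (p. 173)] -/
theorem multiplicity_eq_of_isIsogenous (hB : ∀ q, (B q).IsSimple) (hB0 : ∀ q, 0 < (B q).dim)
    (hni : ∀ q q', q ≠ q' → ¬ IsIsogenous (B q) (B q'))
    (hY : ∀ q, IsIsogenous (Y q) (⨁ fun _ : Fin (n q + 1) ↦ B q)) (i : ∀ q, Y q ⟶ X)
    (hi : ∀ q, IsClosedImmersion (Hom.toSchemeHom (i q))) (hdesc : IsIsogeny (biproduct.desc i))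
    (hY' : ∀ q, IsIsogenous (Y' q) (⨁ fun _ : Fin (n' q + 1) ↦ B q)) (i' : ∀ q, Y' q ⟶ X')
    (hi' : ∀ q, IsClosedImmersion (Hom.toSchemeHom (i' q))) (hdesc' : IsIsogeny (biproduct.desc i'))
    (h : IsIsogenous X X') (q : Q) : n q = n' q := by
  have hd := (isIsogenous_isotypicComponents_of_isIsogenous hB hB0 hni hY i hi hdesc hY' i' hi' hdesc' h q).dim_eq
  rw [(hY q).dim_eq, (hY' q).dim_eq, dim_biproduct_const, dim_biproduct_const, Fintype.card_fin, Fintype.card_fin] at hd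
  have h' := Nat.eq_of_mul_eq_mul_right (hB0 q) hd
  omega

end Perfect

end AbelianVariety

end Literature.AlgebraicGeometry.HodgeTheory

end
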